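import Summits.ValiantsHypothesis.ValiantsHypothesis.Theses.DivisionGap
import Summits.ValiantsHypothesis.ValiantsHypothesis.Theorems.DivisionGapDefs
import Summits.ValiantsHypothesis.ValiantsHypothesis.Theorems.DivisionGapPerDivisionHardStubTorusSupport
import Summits.ValiantsHypothesis.ValiantsHypothesis.Theorems.DivisionGapPerDivisionHardStubFaceDescent
import Summits.ValiantsHypothesis.ValiantsHypothesis.Theorems.DivisionGapPerDivisionHardStubJssContraction
import Summits.ValiantsHypothesis.ValiantsHypothesis.Theorems.DivisionGapPerDivisionHardStubBlockArsenal
import Summits.ValiantsHypothesis.ValiantsHypothesis.Theorems.DivisionGapPerDivisionHardStubSparseRigid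

/-!
# Crux `DivisionGap.PerDivisionHard` (stmt-ValiantsHypothesis-5065) — the SPARSE RUNG, unconditionally

`PerDivisionHard` asks, for every `c` and all large `n`, that every nonzero cofactor
`h ∈ ℝ≥0[x_ij]` satisfies `2^{(log₂ n + c)^c} < L(per_n · h) + L(h)` (monotone fan-in-two
`complexity` over `ℝ≥0`).  This file proves it for all cofactors with at most `2^{(log₂ n + c)^c}`
MONOMIALS, of arbitrary degree:

* `perDivisionHard_sparse` — **∀ c, ∃ n₀, ∀ n ≥ n₀, ∀ h ≠ 0 with `|supp h| ≤ 2^{(log₂ n + c)^c}`: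
  `2^{(log₂ n + c)^c} < L(per_n · h) + L(h)`.**

It is the composition `perDivisionHard_sparse_of` of the v2 skeleton of line
`pair-descent-jss-endpoint` (`Cruxes/PerDivisionHard/Lines/pair-descent-jss-endpoint.lean`), with
every stub a landed theorem of `Theorems/DivisionGapPerDivisionHardStub*.lean`:
torus normal form keeping a sub-support (`stub_torusSupport`) → a placement of the subdivided block
`G(b,k) ⊕ M₀` on which the top fibre of the sparse torus-homogeneous cofactor is a single monomial
(`stub_sparseRigid`, by counting placements) → face descent to `x^u · per_G`
(`stub_faceDescent`) → the monomial is stripped at polynomial cost (`stub_jssContraction`,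
Jukna–Seiwert–Sergeev) → the placed face is harder than that (`stub_blockArsenal`, Jerrum–Snir by
support through the phase bijection).  No degree hypothesis: high-degree sparse cofactors such as
`x^u + x^{u'}` with a balanced difference, which no degree-based rung
(`PerLowDegreeRung.two_pow_le_complexity_perPoly_mul`, `deg h ≤ n - 6`) reaches, are covered.
What remains of the crux after this rung is exactly the dense case (cofactors with more than
quasi-polynomially many monomials), i.e. the registered open stub K2′ of the line.
-/

noncomputable section

-- `Summit.ValiantsHypothesis.ValiantsHypothesis.…` is the tree's mandated single-conjunct layout
-- (Sub = Summit), so the duplicated namespace component is intended.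
set_option linter.dupNamespace false

namespace Summit.ValiantsHypothesis.ValiantsHypothesis.Theorems.DivisionGapPerDivisionHard

open MvPolynomial Literature.Computability.AlgebraicComplexity
open scoped NNReal

/-- **The sparse rung of `PerDivisionHard`.**  For every `c` there is `n₀` such that for all
`n ≥ n₀` and every nonzero `h ∈ ℝ≥0[x_ij]` (`n × n` matrix variables) with at most
`2^{(log₂ n + c)^c}` monomials, `2^{(log₂ n + c)^c} < L(per_n · h) + L(h)` in the monotone
fan-in-two `complexity` over `ℝ≥0`: the permanent admits no quasi-polynomially cheap monotone pair
with a sparse cofactor, whatever its degree.  Composition of the landed stubs of line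
`pair-descent-jss-endpoint` (torus normal form with sub-support, sparse rigidity of a placed
subdivided block face, face descent, Jukna–Seiwert–Sergeev contraction, hardness of the block
face). -/
theorem perDivisionHard_sparse :
    ∀ c : ℕ, ∃ n₀ : ℕ, ∀ n ≥ n₀, ∀ h : MvPolynomial (Fin n × Fin n) ℝ≥0, h ≠ 0 →
      h.support.card ≤ 2 ^ ((Nat.log 2 n + c) ^ c) →
      2 ^ ((Nat.log 2 n + c) ^ c) <
        complexity (perPoly (Fin n) ℝ≥0 * h) + complexity h := by
  intro c
  obtain ⟨κ, hcon⟩ := stub_jssContraction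
  obtain ⟨d, n₁, hhard⟩ := stub_blockArsenal c κ
  obtain ⟨n₀, hS⟩ := stub_sparseRigid c d
  refine ⟨n₀ + n₁, ?_⟩
  intro n hn h hh hcard
  obtain ⟨h', hh', htor, hsupp, hle1, -⟩ := stub_torusSupport n h hh
  by_contra hlt
  have hle : complexity (perPoly (Fin n) ℝ≥0 * h) + complexity h ≤
      2 ^ ((Nat.log 2 n + c) ^ c) := not_lt.mp hlt
  have hcard' : h'.support.card ≤ 2 ^ ((Nat.log 2 n + c) ^ c) :=
    le_trans (Finset.card_le_card hsupp) hcard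
  obtain ⟨b, k, m, eR, eC, w, u, hb, hcut, hsingle⟩ := hS n (by omega) h' hh' htor hcard'
  -- face descent: `x^u · per_G` is (up to one gate) no more expensive than `per · h'`
  have hdesc := stub_faceDescent n (placedBlock eR eC) w h' u hcut hh' hsingle
  have h1 : complexity (monomial u (1 : ℝ≥0) * facePer (placedBlock eR eC)) ≤
      2 ^ ((Nat.log 2 n + c) ^ c) + 1 :=
    calc complexity (monomial u (1 : ℝ≥0) * facePer (placedBlock eR eC))
        ≤ complexity (perPoly (Fin n) ℝ≥0 * h') + 1 := hdesc
      _ ≤ complexity (perPoly (Fin n) ℝ≥0 * h) + 1 := Nat.add_le_add_right hle1 1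
      _ ≤ 2 ^ ((Nat.log 2 n + c) ^ c) + 1 :=
          Nat.add_le_add_right (le_trans (Nat.le_add_right _ _) hle) 1
  -- JSS contraction: strip the monomial at polynomial cost
  have h2 : complexity (facePer (placedBlock eR eC)) ≤
      ((n + 2) * (2 ^ ((Nat.log 2 n + c) ^ c) + 3)) ^ κ :=
    calc complexity (facePer (placedBlock eR eC))
        ≤ ((n + 2) * (complexity (monomial u (1 : ℝ≥0) * facePer (placedBlock eR eC)) + 2)) ^ κ :=
          hcon n (facePer (placedBlock eR eC)) u
      _ ≤ ((n + 2) * (2 ^ ((Nat.log 2 n + c) ^ c) + 3)) ^ κ :=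
          Nat.pow_le_pow_left (Nat.mul_le_mul_left _ (by omega)) κ
  -- the placed block face is harder than that
  have h3 := hhard n (by omega) b k m eR eC hb
  exact absurd (lt_of_lt_of_le h3 h2) (lt_irrefl _)

end Summit.ValiantsHypothesis.ValiantsHypothesis.Theorems.DivisionGapPerDivisionHard

end
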